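import Summits.BirchSwinnertonDyer.BirchSwinnertonDyer.Theorems.BiquadraticEisensteinDescentEisensteinDivisibilityCMInertBadFlatAtOneOfHeartFlatKPrime
import Summits.BirchSwinnertonDyer.BirchSwinnertonDyer.Theorems.InertBadSignedBranchesInertBadAtThreeHeartAbsIrr
import HarnessLib

set_option linter.dupNamespace false -- `Summit.BirchSwinnertonDyer.BirchSwinnertonDyer.Theorems.…` (summit = sub)
set_option autoImplicit false

/-!
# Crux `InertBadAtThree` (stmt-BirchSwinnertonDyer-19225), line `rubin_e1_inert_three` v7 — the heart E_K′@3 from the ♭-HEART@3: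
# `HeartAtThree ⟸ (B) + ♭-heart at p = 3`, the `p = 3` twin of BED's glue `…FlatAtOneOfHeartFlatKPrime.ofPrintFlatK_of_heartFlatK`

Lead-prover seat `bsd-line-ibd-p1` g8 (cell `pub/bsd-wall`, LINE mode on crux 19225). The registered research stub of the line of record,
`stub_heartAtThree : HeartAtThree`, is route `BiquadraticEisensteinDescent`'s crux (E_K′) `EisensteinDivisibilityCMInertBadFlatAtOneKPrime`
with `5 ≤ p` replaced by `p = 3` and NOTHING else changed (text `Cruxes/InertBadAtThree/Lines/rubin_e1_inert_three.lean` l. 97–98). On the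
`p ≥ 5` side that crux was SPLIT (gen 1) into the ♭-heart `EisensteinHeartFlatCMInertBadKPrime` (stmt-21341: `∃ m, p^m · Ch_Λ(X_𝔭′) · 𝓞_ℂp⟦T⟧ ⊆
(Q)`, μ-blind) and the support (Irr) `AbsIrrModPBaseChangeCMInert`, glued by `ofPrintFlatK_of_heartFlatK_of_absIrr` (p-generic chain: unit
content of the ♭-frame `Q` from Hsieh's Thm B + (Irr) — `…StubE2.hasUnitContent_of_isBDPLFunctionInt_of_thmB_anyLevel`, binder `p ≠ 2` —,
the ♭-heart's containment up to `p^m`, prime avoidance in `𝓞_{ℂ_p}⟦T⟧` — `…OfHeartFlat.le_span_of_forall_C_pow_mul_mem` —, constant terms).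
THIS FILE runs the same glue at `p = 3` (`heartAtThree_of_heartFlatAtThree`), with (Irr) at `p = 3` DISCHARGED by this seat's
`…InertBadAtThreeHeartAbsIrr.absIrrModPBaseChangeCMInert_three` (p635155). Consequence for the line: the research stub E_K′@3 is CUT to
the ♭-heart@3 (`HeartFlatAtThree`, hypothesis `hHeart` below = stmt-21341's text at `p = 3`), i.e. the `p = 3` residual of crux 19225 is
aligned with BED's crux 21341 and its line `hsieh_lambda` (companion file `…InertBadAtThreeHeartFlatOfParts`: ♭-heart@3 ⟸ Hsieh witness +
`[√d₀]` + tied Katz frame + THE INPUT V4K at `p = 3`).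

THEOREMS ONLY (no definition, no named fact, no `sorry`); imports no `Theses` module (statements spelled out). CONDITIONAL on the ♭-heart@3
`hHeart` (OPEN research, NOT IN PRINT — Hsieh JAMS 27 (2014) §§7–8 on a `p`-ramified branch, rider R1 «p > 3» at L.7.15/P.7.16) and on (B) in
the conclusion's own antecedent. Supports, does not close, stmt-BirchSwinnertonDyer-19225. BSD is not proved by any of this.

References: [Hsieh2014] M.-L. Hsieh, Doc. Math. 19 (2014), Thm. B p. 712; [Castella2018] F. Castella, arXiv:1704.06608, Thm. 3.1 p. 9;
[BourbakiAC5to7] Algèbre commutative VII §3 no. 8 Prop. 5; [Hsieh2014JAMS] J. Amer. Math. Soc. 27 (2014) Thm. 8.14.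
-/

noncomputable section

open scoped Classical NumberField

open PowerSeries NumberField IsDedekindDomain Field WeierstrassCurve
  Literature.NumberTheory.EllipticCurves Literature.NumberTheory.EllipticCurves.ModularForms
  Literature.NumberTheory.EllipticCurves.Rank1Residual
  Literature.NumberTheory.GaloisRepresentations
  Literature.NumberTheory.EllipticCurves.GreenbergVatsal2000
  Literature.NumberTheory.EllipticCurves.Hida2010MuInvariant
  Literature.NumberTheory.EllipticCurves.Hsieh2014
  Literature.RingTheory.PowerSeries
  Summit.BirchSwinnertonDyer.Rank1Residual.X11b
  Summit.BirchSwinnertonDyer.Rank1Residual.X11b.AcSelmer Summit.BirchSwinnertonDyer.Rank1Residual.X11b.Halves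
  Summit.BirchSwinnertonDyer.BirchSwinnertonDyer.Theorems.BiquadraticEisensteinDescentEisensteinDivisibilityCMInertBadFlatAtOneStubE2
  Summit.BirchSwinnertonDyer.BirchSwinnertonDyer.Theorems.BiquadraticEisensteinDescentEisensteinDivisibilityCMInertBadFlatAtOneOfHeartFlat
  Summit.BirchSwinnertonDyer.BirchSwinnertonDyer.Theorems.InertBadSignedBranchesInertBadAtThreeHeartAbsIrr

namespace Summit.BirchSwinnertonDyer.BirchSwinnertonDyer.Theorems.InertBadSignedBranchesInertBadAtThreeHeartOfHeartFlat

/-- **E_K′@3 ⟸ (B) + ♭-heart@3.** Hypothesis `hHeart` = the ♭-HEART AT `p = 3`: route BED's crux `EisensteinHeartFlatCMInertBadKPrime`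
(stmt-21341) with `5 ≤ p` replaced by `p = 3` — for `W` CM of analytic rank one with `3` CM-inert and bad, `K′` Heegner for `N_W` with
`|d| > 4`, `3 ∤ h(K′)`, `L(W^{(d)},1) ≠ 0`, every anticyclotomic `(κ, γ)`, degree-one `𝔭 ∋ 3`, newform `f`, compatible `ι′`, every ♭-frame
`Q ∈ 𝓞_ℂ₃⟦T⟧` (`X11b.R1.IsBDPLFunctionInt`) and every `𝔭′ ≠ 𝔭` over `3` with `X_ac(W/K′)` strict at `𝔭′` Λ-torsion:
`∃ m, 3^m · Ch_Λ(X_𝔭′) · 𝓞_ℂ₃⟦T⟧ ⊆ (Q)`. Conclusion = `HeartAtThree` of line `rubin_e1_inert_three` (text VERBATIM = (E_K′) at `p = 3`): granted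
Hsieh's Thm B (any level), `Ch_Λ(X_𝔭′)(0) ∈ Q(𝟙) · 𝓞_ℂ₃`. Proof = `ofPrintFlatK_of_heartFlatK_of_absIrr` at `p = 3`: unit content of `Q` from
(B) + (Irr)@3 (`absIrrModPBaseChangeCMInert_three`), the ♭-heart, prime avoidance, constant terms. CONDITIONAL on `hHeart` (OPEN).
[cite: Hsieh2014, Thm. B p. 712 (Doc. Math. 19)] [cite: Castella2018, Thm. 3.1 (arXiv:1704.06608 p. 9)] -/
theorem heartAtThree_of_heartFlatAtThree
    (hHeart : ∀ (W : WeierstrassCurve ℚ) [W.IsElliptic] [W.IsGloballyMinimal] (p : ℕ) [Fact p.Prime]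
      [NeZero (W.conductorNorm ℤ)] (K : Type) [Field K] [NumberField K],
      W.HasCM → W.analyticRank = 1 → p = 3 → CMInert W p → ¬ Good W p →
      IsImaginaryQuadratic K → SatisfiesHeegnerHypothesis (W.conductorNorm ℤ) K →
      4 < (NumberField.discr K).natAbs →
      ¬ p ∣ NumberField.classNumber K →
      (W.quadraticTwist (NumberField.discr K : ℚ)).entireLFunction 1 ≠ 0 →
      ∀ (κ : ZpExtension K p), κ.IsAnticyclotomic →
        ∀ (γ : Field.absoluteGaloisGroup K) [Fact (κ.IsTopGenerator γ)]
          (𝔭 : HeightOneSpectrum (𝓞 K)), ((p : ℕ) : 𝓞 K) ∈ 𝔭.asIdeal →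
          𝔭.asIdeal.ramificationIdx (𝓞 ℚ) = 1 → 𝔭.asIdeal.inertiaDeg (𝓞 ℚ) = 1 →
          ∀ (f : CuspForm (CongruenceSubgroup.Gamma0 (W.conductorNorm ℤ)) 2), IsNewformOf W f →
            ∀ (ι' : PadicAlgCl p ≃+* ℂ),
              (∀ (w : InfinitePlace K) (k : 𝓞 K), k ∈ 𝔭.asIdeal ↔ ‖ι'.symm (w.embedding (k : K))‖ < 1) →
              ∀ (ΩK : ℂ) (Ωp : (unrIntegers p)ˣ) (Q : PowerSeries (PadicComplexInt p)), ΩK ≠ 0 →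
                R1.IsBDPLFunctionInt p ι' 𝔭 κ γ f ΩK ((Ωp : unrIntegers p) : (PadicComplex p)) Q →
                  ∀ (𝔭' : HeightOneSpectrum (𝓞 K)), ((p : ℕ) : 𝓞 K) ∈ 𝔭'.asIdeal → 𝔭' ≠ 𝔭 →
                  Module.IsTorsion (IwasawaAlgebra p) (XAc (W.baseChange K) p κ 𝔭' ∅ γ) →
                  ∃ m : ℕ, ∀ x ∈ (XAc.charIdeal (W.baseChange K) p κ 𝔭' ∅ γ).map (PowerSeries.map (R1.toCpInt p)),
                    (PowerSeries.C ((p : ℕ) : PadicComplexInt p) : PowerSeries (PadicComplexInt p)) ^ m * x ∈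
                      Ideal.span {Q}) :
  thmB_exists_isHsiehLFunction_coeff_norm_eq_one_unrPeriod_anyLevel →
  ∀ (W : WeierstrassCurve ℚ) [W.IsElliptic] [W.IsGloballyMinimal] (p : ℕ) [Fact p.Prime]
    [NeZero (W.conductorNorm ℤ)] (K : Type) [Field K] [NumberField K],
    W.HasCM → W.analyticRank = 1 → p = 3 → CMInert W p → ¬ Good W p →
    IsImaginaryQuadratic K → SatisfiesHeegnerHypothesis (W.conductorNorm ℤ) K →
    4 < (NumberField.discr K).natAbs →
    ¬ p ∣ NumberField.classNumber K →
    (W.quadraticTwist (NumberField.discr K : ℚ)).entireLFunction 1 ≠ 0 →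
    ∀ (κ : ZpExtension K p), κ.IsAnticyclotomic →
      ∀ (γ : Field.absoluteGaloisGroup K) [Fact (κ.IsTopGenerator γ)]
        (𝔭 : HeightOneSpectrum (𝓞 K)), ((p : ℕ) : 𝓞 K) ∈ 𝔭.asIdeal →
        𝔭.asIdeal.ramificationIdx (𝓞 ℚ) = 1 → 𝔭.asIdeal.inertiaDeg (𝓞 ℚ) = 1 →
        ∀ (𝔭' : HeightOneSpectrum (𝓞 K)), ((p : ℕ) : 𝓞 K) ∈ 𝔭'.asIdeal → 𝔭' ≠ 𝔭 →
        Module.IsTorsion (IwasawaAlgebra p) (XAc (W.baseChange K) p κ 𝔭' ∅ γ) →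
        ∀ (f : CuspForm (CongruenceSubgroup.Gamma0 (W.conductorNorm ℤ)) 2), IsNewformOf W f →
          ∀ (ι' : PadicAlgCl p ≃+* ℂ),
            (∀ (w : InfinitePlace K) (k : 𝓞 K), k ∈ 𝔭.asIdeal ↔ ‖ι'.symm (w.embedding (k : K))‖ < 1) →
            ∀ (ΩK : ℂ) (Ωp : (unrIntegers p)ˣ) (Q : PowerSeries (PadicComplexInt p)), ΩK ≠ 0 →
              R1.IsBDPLFunctionInt p ι' 𝔭 κ γ f ΩK ((Ωp : unrIntegers p) : (PadicComplex p)) Q →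
                (XAc.charIdeal (W.baseChange K) p κ 𝔭' ∅ γ).map
                    ((R1.toCpInt p).comp (PowerSeries.constantCoeff : IwasawaAlgebra p →+* ℤ_[p])) ≤
                  Ideal.span {PowerSeries.constantCoeff Q} := by
  intro hB W _ _ p _ _ K _ _ hCM hr hp3 hin hbad hK hHN hd4 hadm hLt κ hκ γ hγ 𝔭 h𝔭 he hf 𝔭' h𝔭' hne htors f
    hfW ι' hι' ΩK Ωp Q hΩK hQ
  have hp2 : p ≠ 2 := by omega
  have hpN : p ∣ W.conductorNorm ℤ := (W.dvd_conductorNorm_iff_not_hasGoodReductionAtPrime p).mpr hbad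
  -- (E2♭) unit content of `Q`, from (B) + (Irr)@3
  have hQc : HasUnitContent Q :=
    hasUnitContent_of_isBDPLFunctionInt_of_thmB_anyLevel hB W hp2 hpN hfW hK hHN h𝔭 hι'
      (absIrrModPBaseChangeCMInert_three W p hCM hp3 hin hbad K hK hHN) hκ hγ.out hΩK (coe_units_unrIntegers_ne_zero Ωp) hQ
  -- the ♭-heart@3: containment up to `p^m`
  obtain ⟨m, hm⟩ := hHeart W p K hCM hr hp3 hin hbad hK hHN hd4 hadm hLt κ hκ γ 𝔭 h𝔭 he hf f hfW ι' hι' ΩK Ωp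
    Q hΩK hQ 𝔭' h𝔭' hne htors
  -- (E3♭) prime avoidance
  have hflat : (XAc.charIdeal (W.baseChange K) p κ 𝔭' ∅ γ).map (PowerSeries.map (R1.toCpInt p)) ≤
      Ideal.span {Q} := le_span_of_forall_C_pow_mul_mem hQc hm
  -- constant terms
  have hcc : ∀ g : IwasawaAlgebra p, PowerSeries.constantCoeff (PowerSeries.map (R1.toCpInt p) g) =
      R1.toCpInt p (PowerSeries.constantCoeff g) := fun g ↦ by
    rw [← PowerSeries.coeff_zero_eq_constantCoeff_apply, PowerSeries.coeff_map,
      PowerSeries.coeff_zero_eq_constantCoeff_apply]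
  have hcomp : (R1.toCpInt p).comp (PowerSeries.constantCoeff : IwasawaAlgebra p →+* ℤ_[p]) =
      (PowerSeries.constantCoeff : PowerSeries 𝓞_ℂ_[p] →+* 𝓞_ℂ_[p]).comp (PowerSeries.map (R1.toCpInt p)) := by
    ext g
    simp [hcc]
  rw [hcomp, ← Ideal.map_map]
  refine (Ideal.map_mono hflat).trans ?_
  rw [Ideal.map_span, Set.image_singleton]

end Summit.BirchSwinnertonDyer.BirchSwinnertonDyer.Theorems.InertBadSignedBranchesInertBadAtThreeHeartOfHeartFlat

end
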